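import Summits.MatrixMultiplication.MatrixMultiplication.Theorems.SoloBlindOlsonBerman
import Summits.MatrixMultiplication.MatrixMultiplication.Theorems.SoloBlindLift

/-!
# Solo-blind seat (MatrixMultiplication), s84 — THE TOP-LAYER KRAFT CONGRUENCE for Conjecture E
(KraftK3 §7, K3.28; CLAIMS c1001)

Door I1⁗ / Conjecture E (`E(σ;S) = Σ_{T ⊆ S, Σ_T = σ} 2^{-|T|} ≤ 1/2` for `S` zero-sum free and `σ` H-good).
On the TOP LAYER of `𝔽₃^r` — `|S| = 2r - 1`, so that the extended family `S·σ` is a zero-sum-free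
sequence of the maximal length `2r` — the OLSON–BERMAN congruence `soloBlindOB_kraft_congruence`
(`2^{2r} K(τ) ≡ 1 (mod 3)` for every target of a maximal zero-sum-free sequence), applied to `S·σ` at the
target `σ` and combined with `E_{S·σ}(σ) = E(σ;S) + ½` (the only representation of `σ` through the new
member is the singleton, `S` being zero-sum free), gives

* `soloBlindTLC_congruence`: `2^{|S|} · E(σ;S) = 3z + 1` for an integer `z` — the Kraft mass of an
  H-good target on the top layer is `≡ 1 (mod 3)` after clearing denominators;
* `soloBlindTLC_gap`: consequently, if every representation of `σ` has at most `M` members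
  (`1 ≤ M ≤ |S|`), then `E(σ;S) = ½`, or `E(σ;S) ≤ ½ - 3·2^{-M}`, or `E(σ;S) ≥ ½ + 3·2^{-M}`:
  around the conjectured extremal value `½` there is a gap of width `3·2^{-M}` on the top layer.

With `M = ρ + 1` this is exactly the second value `½ - 3·2^{-(ρ+1)}` observed in the complete top-layer
censuses of ranks 3, 4, 5 (K3.27, Q-K69) and attained there only by pairs whose largest representation
has `ρ + 1` members.  Supporting lemmas: clearing denominators (`soloBlindTLC_two_pow_mul_mass`) and
invariance of the mass under re-indexing (`soloBlindTLC_mass_comp_embedding`).  Pure finite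
combinatorics over `𝔽₃`; nothing here bears on `ω`.
-/

set_option linter.dupNamespace false

namespace Summit.MatrixMultiplication.MatrixMultiplication.Theorems

open Finset

variable {ι : Type*} [DecidableEq ι]
variable {G : Type*} [AddCommGroup G] [DecidableEq G]

omit [DecidableEq ι] in
/-- CLEARING DENOMINATORS.  If every representation of `τ` inside `S` has at most `c` members, then
`2^c · E(τ;S) = Σ_T 2^{c-|T|}` is a natural number. -/
theorem soloBlindTLC_two_pow_mul_mass (h : ι → G) (S : Finset ι) (τ : G) (c : ℕ)
    (hc : ∀ T ∈ soloBlindSeqRepAll h S τ, T.card ≤ c) :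
    (2 : ℚ) ^ c * soloBlindMass h S τ =
      ((∑ T ∈ soloBlindSeqRepAll h S τ, 2 ^ (c - T.card) : ℕ) : ℚ) := by
  unfold soloBlindMass
  rw [mul_sum]
  push_cast
  refine sum_congr rfl fun T hT => ?_
  have h2 : (2 : ℚ) ^ c = 2 ^ (c - T.card) * 2 ^ T.card := by
    rw [← pow_add, Nat.sub_add_cancel (hc T hT)]
  rw [h2, mul_assoc, ← mul_pow]
  norm_num

omit [DecidableEq ι] in
/-- Every representation inside `S` has at most `|S|` members. -/
theorem soloBlindTLC_card_rep_le (h : ι → G) (S : Finset ι) (τ : G) :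
    ∀ T ∈ soloBlindSeqRepAll h S τ, T.card ≤ S.card := by
  intro T hT
  unfold soloBlindSeqRepAll at hT
  exact card_le_card (mem_powerset.1 (mem_filter.1 hT).1)

omit [DecidableEq ι] [DecidableEq G] in
/-- The powerset of an injective image is the image of the powerset. -/
theorem soloBlindTLC_powerset_map {κ : Type*} (e : κ ↪ ι) (S : Finset κ) :
    (S.map e).powerset = S.powerset.map (mapEmbedding e).toEmbedding := by
  ext T
  simp only [mem_powerset, mem_map, RelEmbedding.coe_toEmbedding, mapEmbedding_apply]
  constructor
  · intro hT
    obtain ⟨U, hU, rfl⟩ := subset_map_iff.1 hT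
    exact ⟨U, hU, rfl⟩
  · rintro ⟨U, hU, rfl⟩
    exact map_subset_map.2 hU

omit [DecidableEq ι] in
/-- RE-INDEXING.  The Kraft mass of the pulled-back family `h ∘ e` on `S` is the Kraft mass of `h` on the
image `S.map e`, for an injective re-indexing `e`. -/
theorem soloBlindTLC_mass_comp_embedding {κ : Type*} (e : κ ↪ ι) (h : ι → G) (S : Finset κ)
    (τ : G) : soloBlindMass (fun k => h (e k)) S τ = soloBlindMass h (S.map e) τ := by
  rw [soloBlindLift_mass_eq_ite, soloBlindLift_mass_eq_ite, soloBlindTLC_powerset_map, sum_map]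
  refine sum_congr rfl fun T _ => ?_
  simp only [RelEmbedding.coe_toEmbedding, mapEmbedding_apply, card_map, sum_map]

variable {r : ℕ}

/-- THE TOP-LAYER KRAFT CONGRUENCE.  If `S` is zero-sum free in `𝔽₃^r` with `|S| + 1 = 2r` and `σ` is
H-good (`σ + Σ_T ≠ 0` for all `T ⊆ S`), then `2^{|S|} · E(σ;S) ≡ 1 (mod 3)`:
`2^{|S|} E(σ;S) = 3z + 1` for some integer `z`.  [Olson–Berman for the maximal sequence `S·σ` at the
target `σ`, whose representations are those of `σ` in `S` together with the singleton of the new member.] -/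
theorem soloBlindTLC_congruence (h : ι → (Fin r → ZMod 3)) (S : Finset ι) (σ : Fin r → ZMod 3)
    (zsf : ∀ T ⊆ S, T.Nonempty → ∑ i ∈ T, h i ≠ 0) (hσ : ∀ T ⊆ S, σ + ∑ i ∈ T, h i ≠ 0)
    (hcard : S.card + 1 = 2 * r) :
    ∃ z : ℤ, (2 : ℚ) ^ S.card * soloBlindMass h S σ = 3 * z + 1 := by
  classical
  -- the extended family `S·σ` on `Option ι`, enumerated by `Fin (|S|+1)`
  set f : Option ι → (Fin r → ZMod 3) := fun o => o.elim σ h with hf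
  have zsfF := soloBlindTLO_zsf_insertNone h σ S zsf hσ
  set F : Finset (Option ι) := insertNone S with hF
  have hFS : F.card = S.card + 1 := by rw [hF, card_insertNone]
  have hFc : F.card = 2 * r := by rw [hFS]; exact hcard
  let emb : Fin F.card ↪ Option ι :=
    ⟨fun k => ((F.equivFin.symm k : F) : Option ι),
      fun k l hkl => F.equivFin.symm.injective (Subtype.ext hkl)⟩
  have hmapF : (univ : Finset (Fin F.card)).map emb = F := by
    ext o
    constructor
    · intro ho
      obtain ⟨k, -, rfl⟩ := mem_map.mp ho
      exact (F.equivFin.symm k).2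
    · intro ho
      refine mem_map.mpr ⟨F.equivFin ⟨o, ho⟩, mem_univ _, ?_⟩
      simp [emb]
  have hz : ∀ T : Finset (Fin F.card), T.Nonempty → ∑ k ∈ T, f (emb k) ≠ 0 := by
    intro T hT
    have hsub : T.map emb ⊆ F := by
      intro y hy
      obtain ⟨k, -, rfl⟩ := mem_map.mp hy
      exact (F.equivFin.symm k).2
    have h0 := zsfF (T.map emb) hsub (map_nonempty.mpr hT)
    rwa [sum_map] at h0
  -- Olson–Berman for the enumerated maximal sequence, at the target `σ`
  have hOB := soloBlindOB_kraft_congruence (fun k => f (emb k)) hz hFc σ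
  -- the integer there is `2^{|S|+1} · E_{S·σ}(σ)`
  have hrepsF : ∀ T ∈ soloBlindSeqRepAll (fun k => f (emb k)) univ σ, T.card ≤ F.card := by
    intro T _
    simpa using card_le_univ T
  have hB := soloBlindTLC_two_pow_mul_mass (fun k => f (emb k)) univ σ F.card hrepsF
  have hsumeq : ((∑ T ∈ soloBlindSeqRepAll (fun k => f (emb k)) univ σ, 2 ^ (F.card - T.card) : ℕ)
      : ℤ) = ∑ T ∈ (univ : Finset (Fin F.card)).powerset with ∑ k ∈ T, f (emb k) = σ,
        (2 : ℤ) ^ (F.card - T.card) := by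
    unfold soloBlindSeqRepAll
    push_cast
    rfl
  rw [← hsumeq] at hOB
  -- `E_{S·σ}(σ) = E(σ;S) + ½`
  have hmassF : soloBlindMass (fun k => f (emb k)) univ σ = soloBlindMass h S σ + 1 / 2 := by
    rw [soloBlindTLC_mass_comp_embedding emb f univ σ, hmapF, hF, hf, soloBlindLift_mass_insertNone,
      sub_self, soloBlindLift_mass_zero h S zsf]
  -- `2^{|S|} E(σ;S)` is a natural number `NS`
  have hBS := soloBlindTLC_two_pow_mul_mass h S σ S.card (soloBlindTLC_card_rep_le h S σ)
  set NS : ℕ := ∑ T ∈ soloBlindSeqRepAll h S σ, 2 ^ (S.card - T.card) with hNS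
  set NF : ℕ := ∑ T ∈ soloBlindSeqRepAll (fun k => f (emb k)) univ σ, 2 ^ (F.card - T.card) with hNF
  -- `NF = 2 NS + 2^{|S|}`
  have hrelQ : (NF : ℚ) = 2 * NS + 2 ^ S.card := by
    rw [← hB, ← hBS, hmassF, hFS, pow_succ]
    ring
  have hrel : (NF : ℤ) = 2 * NS + 2 ^ S.card := by exact_mod_cast hrelQ
  -- `3 ∣ 2^{|S|} + 1` (`|S|` is odd)
  have hodd : Odd S.card := ⟨r - 1, by omega⟩
  have h3 : (3 : ℤ) ∣ 2 ^ S.card + 1 := by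
    have := Odd.add_dvd_pow_add_pow (2 : ℤ) 1 hodd
    simpa using this
  -- hence `3 ∣ NS - 1`
  have hdvd2 : (3 : ℤ) ∣ 2 * ((NS : ℤ) - 1) := by
    have : 2 * ((NS : ℤ) - 1) = ((NF : ℤ) - 1) - (2 ^ S.card + 1) := by rw [hrel]; ring
    rw [this]
    exact dvd_sub hOB h3
  have hdvd : (3 : ℤ) ∣ (NS : ℤ) - 1 := by
    rcases (Int.prime_three.dvd_mul).1 hdvd2 with h2 | h2
    · exact absurd h2 (by norm_num)
    · exact h2
  obtain ⟨z, hz3⟩ := hdvd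
  refine ⟨z, ?_⟩
  have hzQ : ((NS : ℤ) : ℚ) - 1 = 3 * z := by exact_mod_cast hz3
  rw [hBS]
  push_cast at hzQ ⊢
  linarith

/-- THE TOP-LAYER GAP.  On the top layer (`S` zero-sum free in `𝔽₃^r`, `|S| + 1 = 2r`, `σ` H-good), if
every representation of `σ` has at most `M` members (`1 ≤ M ≤ |S|`), then `2^M (E(σ;S) - ½)` is an
integer divisible by `3`; hence `E(σ;S) = ½`, or `E(σ;S) ≤ ½ - 3·2^{-M}`, or `E(σ;S) ≥ ½ + 3·2^{-M}`. -/
theorem soloBlindTLC_gap (h : ι → (Fin r → ZMod 3)) (S : Finset ι) (σ : Fin r → ZMod 3)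
    (zsf : ∀ T ⊆ S, T.Nonempty → ∑ i ∈ T, h i ≠ 0) (hσ : ∀ T ⊆ S, σ + ∑ i ∈ T, h i ≠ 0)
    (hcard : S.card + 1 = 2 * r) (M : ℕ) (hM1 : 1 ≤ M) (hMc : M ≤ S.card)
    (hM : ∀ T ⊆ S, ∑ i ∈ T, h i = σ → T.card ≤ M) :
    soloBlindMass h S σ = 1 / 2 ∨ soloBlindMass h S σ ≤ 1 / 2 - 3 / 2 ^ M ∨
      1 / 2 + 3 / 2 ^ M ≤ soloBlindMass h S σ := by
  classical
  obtain ⟨z, hz⟩ := soloBlindTLC_congruence h S σ zsf hσ hcard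
  have hrepsM : ∀ T ∈ soloBlindSeqRepAll h S σ, T.card ≤ M := by
    intro T hT
    unfold soloBlindSeqRepAll at hT
    exact hM T (mem_powerset.1 (mem_filter.1 hT).1) (mem_filter.1 hT).2
  have hBM := soloBlindTLC_two_pow_mul_mass h S σ M hrepsM
  set NM : ℕ := ∑ T ∈ soloBlindSeqRepAll h S σ, 2 ^ (M - T.card) with hNM
  -- `2^{|S|-M} NM = 3z + 1`
  have h1 : (2 : ℚ) ^ (S.card - M) * NM = 3 * z + 1 := by
    rw [← hz, ← hBM, ← mul_assoc, ← pow_add, Nat.sub_add_cancel hMc]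
  have h1Z : (2 : ℤ) ^ (S.card - M) * NM = 3 * z + 1 := by exact_mod_cast h1
  -- `3 ∣ 2^{|S|-1} - 1` (`|S| - 1` is even)
  have h4 : (3 : ℤ) ∣ 2 ^ (S.card - 1) - 1 := by
    have h41 : (3 : ℤ) ∣ 4 ^ (r - 1) - 1 := by simpa using sub_dvd_pow_sub_pow (4 : ℤ) 1 (r - 1)
    have : (2 : ℤ) ^ (S.card - 1) = 4 ^ (r - 1) := by
      rw [show S.card - 1 = 2 * (r - 1) by omega, pow_mul]; norm_num
    rwa [this]
  -- `3 ∣ 2^{|S|-M} (NM - 2^{M-1})`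
  have hpow : (2 : ℤ) ^ (S.card - M) * 2 ^ (M - 1) = 2 ^ (S.card - 1) := by
    rw [← pow_add]; congr 1; omega
  have hdvdM : (3 : ℤ) ∣ 2 ^ (S.card - M) * ((NM : ℤ) - 2 ^ (M - 1)) := by
    have : (2 : ℤ) ^ (S.card - M) * ((NM : ℤ) - 2 ^ (M - 1)) = 3 * z - (2 ^ (S.card - 1) - 1) := by
      rw [mul_sub, h1Z, hpow]; ring
    rw [this]
    exact dvd_sub (dvd_mul_right 3 z) h4
  have hdvd : (3 : ℤ) ∣ (NM : ℤ) - 2 ^ (M - 1) := by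
    rcases (Int.prime_three.dvd_mul).1 hdvdM with h2 | h2
    · exact absurd (Int.prime_three.dvd_of_dvd_pow h2) (by norm_num)
    · exact h2
  obtain ⟨w, hw⟩ := hdvd
  -- `2^M (E - ½) = 3w`
  have hP : (0 : ℚ) < 2 ^ M := by positivity
  have h2M : (2 : ℚ) ^ M = 2 * 2 ^ (M - 1) := by
    rw [← pow_succ']; congr 1; omega
  have hwQ : ((NM : ℤ) : ℚ) - 2 ^ (M - 1) = 3 * w := by exact_mod_cast hw
  push_cast at hwQ
  have key : (soloBlindMass h S σ - 1 / 2) * 2 ^ M = 3 * w := by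
    rw [sub_mul, mul_comm, hBM, h2M]
    linarith
  rcases lt_trichotomy w 0 with hneg | h0 | hpos
  · right; left
    have hw1 : (w : ℚ) + 1 ≤ 0 := by exact_mod_cast Int.lt_iff_add_one_le.mp hneg
    have hle : soloBlindMass h S σ - 1 / 2 ≤ (-3) / 2 ^ M := by
      rw [le_div_iff₀ hP, key]; linarith
    rw [neg_div] at hle
    linarith
  · left
    have : (w : ℚ) = 0 := by exact_mod_cast h0
    have h00 : (soloBlindMass h S σ - 1 / 2) * 2 ^ M = 0 := by rw [key, this, mul_zero]
    rcases mul_eq_zero.1 h00 with h01 | h01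
    · linarith
    · exact absurd h01 (ne_of_gt hP)
  · right; right
    have hw1 : (1 : ℚ) ≤ w := by exact_mod_cast Int.lt_iff_add_one_le.mp hpos
    have hle : 3 / 2 ^ M ≤ soloBlindMass h S σ - 1 / 2 := by
      rw [div_le_iff₀ hP, key]; linarith
    linarith

end Summit.MatrixMultiplication.MatrixMultiplication.Theorems
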